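import Summits.RiemannHypothesis.RiemannHypothesis.Theorems.SignConePointwiseCertThreeHalvesData
import Summits.RiemannHypothesis.RiemannHypothesis.Theorems.SignConeCondRungSOSFiftyFiveData

/-!
# Route SignCone: pointwise certificate `pwCert32` (b = 3/2) — SOS tail bound in kernel chunks (C)

Support for the unconditional rung `a ≤ 3/2` (items stmt-RiemannHypothesis-16302 / 16301). The tail clause of the corrected
checker needs `sosBound` of the Dirichlet-SOS certificate `pwCert32sos` (basis `1..90`, rank `62`): too large for one kernel
evaluation, so it is bounded row-chunk by row-chunk (`SOSData.sosBound_eq_sumR`, `sumR_add'`, `decide +kernel`), and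
`pwCert32_tailH` is then DERIVED (file `…ThreeHalvesTail`).
-/

noncomputable section

-- `Summit.RiemannHypothesis.RiemannHypothesis.…` repeats a namespace component by design (D-0017 layout).
set_option linter.dupNamespace false

open Literature.Analysis.ValidatedNumerics.Numerics Literature.NumberTheory.LFunctions

namespace Summit.RiemannHypothesis.RiemannHypothesis.Theorems.SignCone

set_option maxHeartbeats 0 in
/-- Row chunk `p' ∈ [45, 55)` of `pwCert32sos.sosBound`. [folklore] -/
theorem pwCert32_sosChunk9 :
    (sumR 10 fun i => pwCert32sos.sosInner pwCert32.nodeList pwCert32.a (45 + i)) ≤ (317/5000000) := by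
  decide +kernel

set_option maxHeartbeats 0 in
/-- Row chunk `p' ∈ [55, 65)` of `pwCert32sos.sosBound`. [folklore] -/
theorem pwCert32_sosChunk10 :
    (sumR 10 fun i => pwCert32sos.sosInner pwCert32.nodeList pwCert32.a (55 + i)) ≤ (523/10000000) := by
  decide +kernel

set_option maxHeartbeats 0 in
/-- Row chunk `p' ∈ [65, 77)` of `pwCert32sos.sosBound`. [folklore] -/
theorem pwCert32_sosChunk11 :
    (sumR 12 fun i => pwCert32sos.sosInner pwCert32.nodeList pwCert32.a (65 + i)) ≤ (467/10000000) := by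
  decide +kernel

set_option maxHeartbeats 0 in
/-- Row chunk `p' ∈ [77, 90)` of `pwCert32sos.sosBound`. [folklore] -/
theorem pwCert32_sosChunk12 :
    (sumR 13 fun i => pwCert32sos.sosInner pwCert32.nodeList pwCert32.a (77 + i)) ≤ (479/10000000) := by
  decide +kernel

end Summit.RiemannHypothesis.RiemannHypothesis.Theorems.SignCone

end
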